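import Summits.Parity.GeneralizedHardyLittlewood.Theorems.LeeYangFibresAbsoluteUpgradeUniformDefs
import Summits.Parity.GeneralizedHardyLittlewood.Theorems.LeeYangFibresAbsoluteUpgradeUniformGrowth
import Mathlib.Analysis.SpecialFunctions.Pow.Asymptotics
import HarnessLib

/-!
# Route `LeeYangFibres`, crux `AbsoluteUpgrade` (stmt-Parity-14116), line `Sketch` (uniform amplification):
# limit, bookkeeping and growth facts for the glue `stub_uniformSingularMeanGlue` (part 2)

Sorry-free auxiliary facts used by `LeeYangFibresAbsoluteUpgradeUniformSingularMeanGlue.lean`: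

* `limit_sandwich` (registered sub-goal of this file) — the passage `x → ∞` in the weighted sum over the
  non-degenerate shifts of the pointwise sandwich
  `ρ s_x^k F(H) ≤ F_p S_H(x) ≤ s_x^k F(H) (1 + med_x(H) + tail_x(H))`, given the AVERAGED bound
  `∑_H w F med_x ≤ M` (medium collisions) and the POINTWISE bound `tail_x ≤ η` (tail collisions):
  `ρ (lim s)^k ∑ w F ≤ F_p ∑ w lim S_H ≤ (lim s)^k ((1+η) ∑ w F + M)`;
* (sub-namespace `GlueProof`) `uniform_glue_algebra` — the final real-arithmetic bookkeeping (cubes, archimedean sums, degenerate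
  shifts, the ratio `(𝔖/F₀)^{m+1} ≤ κ`);
* `eventually_const_mul_rpow_le`, `mul_le_rpow_add₄` and `eventually_glue_junk` — every junk factor of the glue
  (`𝔖^{m+1}`, `m 4^m`, `(3/2)^{m+1}`, `4m 7^m`, `∏_{p ≤ y_N} p ≤ N^{(log 4)/4}`, `(log N)^T`, `T² 5^m`) is
  eventually `≤ η N` against the spare factor `N`, UNIFORMLY in `(m+1)t ≤ (log log N)^A`
  (toolkit `LeeYangFibresAbsoluteUpgradeUniformGrowth`).

References: P. X. Gallagher, Mathematika 23 (1976), §2 [Gallagher1976]; B. Green, T. Tao, Ann. of Math. 171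
(2010), Lemma 1.3 [GreenTao2010].
-/

noncomputable section

open scoped BigOperators Classical Topology
open Finset Filter MeasureTheory Literature.NumberTheory.Sieve
open Summit.Parity.GeneralizedHardyLittlewood.Cruxes.RelativeDimOne.TranslateAmplification

namespace Summit.Parity.GeneralizedHardyLittlewood.Cruxes.AbsoluteUpgrade.UniformAmplification

/-! ### The limit `x → ∞` -/

/-- **The limit sandwich** (registered sub-goal of this file). For a finite set `G` of shifts with weights
`w, F ≥ 0`, sequences `S_H(x) → S_H` (`H ∈ G`) and `s(x) → s ≥ 0`, a constant `F_p` and an exponent `k`: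
if for all `x ≥ y` and `H ∈ G`, `ρ s(x)^k F(H) ≤ F_p S_H(x) ≤ s(x)^k F(H) (1 + med_H(x) + tail_H(x))` with
`tail_H(x) ≤ η` pointwise and `∑_{H ∈ G} w(H) F(H) med_H(x) ≤ M` on average, then
`ρ s^k ∑_G w F ≤ F_p ∑_G w(H) S_H ≤ s^k ((1 + η) ∑_G w F + M)`. [folklore] -/
theorem limit_sandwich : ∀ {ι : Type} (G : Finset ι) (w F : ι → ℝ) (S : ι → ℕ → ℝ) (s : ℕ → ℝ) (med tail : ι → ℕ → ℝ) (Slim : ι → ℝ) (slim ρ Fp η M : ℝ) (k y : ℕ), (∀ H ∈ G, 0 ≤ w H) → (∀ H ∈ G, 0 ≤ F H) → (∀ x, 0 ≤ s x) → (∀ H ∈ G, ∀ x, y ≤ x → ρ * s x ^ k * F H ≤ Fp * S H x ∧ Fp * S H x ≤ s x ^ k * F H * (1 + med H x + tail H x)) → (∀ H ∈ G, ∀ x, tail H x ≤ η) → (∀ x, ∑ H ∈ G, w H * F H * med H x ≤ M) → (∀ H ∈ G, Tendsto (S H) atTop (𝓝 (Slim H))) → Tendsto s atTop (𝓝 slim)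 → ρ * slim ^ k * ∑ H ∈ G, w H * F H ≤ Fp * ∑ H ∈ G, w H * Slim H ∧ Fp * ∑ H ∈ G, w H * Slim H ≤ slim ^ k * ((1 + η) * ∑ H ∈ G, w H * F H + M) := by
  intro ι G w F S s med tail Slim slim ρ Fp η M k y hw hF hs hsand htail hmed hS hslim
  have hf : Tendsto (fun x => Fp * ∑ H ∈ G, w H * S H x) atTop (𝓝 (Fp * ∑ H ∈ G, w H * Slim H)) :=
    (tendsto_finsetSum G fun H hH => (hS H hH).const_mul (w H)).const_mul Fp
  have hg₁ : Tendsto (fun x => ρ * s x ^ k * ∑ H ∈ G, w H * F H) atTop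
      (𝓝 (ρ * slim ^ k * ∑ H ∈ G, w H * F H)) :=
    ((hslim.pow k).const_mul ρ).mul_const _
  have hg₂ : Tendsto (fun x => s x ^ k * ((1 + η) * ∑ H ∈ G, w H * F H + M)) atTop
      (𝓝 (slim ^ k * ((1 + η) * ∑ H ∈ G, w H * F H + M))) :=
    (hslim.pow k).mul_const _
  constructor
  · refine le_of_tendsto_of_tendsto hg₁ hf (Filter.eventually_atTop.mpr ⟨y, fun x hx => ?_⟩)
    dsimp only
    rw [Finset.mul_sum, Finset.mul_sum]
    refine Finset.sum_le_sum fun H hH => ?_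
    calc ρ * s x ^ k * (w H * F H) = w H * (ρ * s x ^ k * F H) := by ring
      _ ≤ w H * (Fp * S H x) := mul_le_mul_of_nonneg_left (hsand H hH x hx).1 (hw H hH)
      _ = Fp * (w H * S H x) := by ring
  · refine le_of_tendsto_of_tendsto hf hg₂ (Filter.eventually_atTop.mpr ⟨y, fun x hx => ?_⟩)
    dsimp only
    have hsk : 0 ≤ s x ^ k := pow_nonneg (hs x) k
    calc Fp * ∑ H ∈ G, w H * S H x = ∑ H ∈ G, w H * (Fp * S H x) := by
          rw [Finset.mul_sum]
          exact Finset.sum_congr rfl fun H _ => by ring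
      _ ≤ ∑ H ∈ G, w H * (s x ^ k * F H * (1 + med H x + η)) := by
          refine Finset.sum_le_sum fun H hH => mul_le_mul_of_nonneg_left ?_ (hw H hH)
          refine (hsand H hH x hx).2.trans ?_
          exact mul_le_mul_of_nonneg_left (by linarith [htail H hH x]) (mul_nonneg hsk (hF H hH))
      _ = s x ^ k * ((1 + η) * ∑ H ∈ G, w H * F H + ∑ H ∈ G, w H * F H * med H x) := by
          rw [Finset.mul_sum, mul_add, Finset.mul_sum, Finset.mul_sum, ← Finset.sum_add_distrib]
          exact Finset.sum_congr rfl fun H _ => by ring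
      _ ≤ s x ^ k * ((1 + η) * ∑ H ∈ G, w H * F H + M) := by
          gcongr
          exact hmed x

namespace GlueProof

/-! ### The bookkeeping -/

/-- **The bookkeeping of the uniform glue.** With `B = S_box − D ≥ 0` (the non-degenerate part of the
truncated weighted sum), the limit sandwich `ρ 𝔖^{m+1} B ≤ F₀^{m+1} A ≤ 𝔖^{m+1}((1+η)B + η F₀^{m+1}(W_box + X))`,
the cube estimate `|S_box − F₀^{m+1} W_box| ≤ E₁`, the archimedean sum `|W_box − V^{m+1}| ≤ E₃`, the degenerate
shifts `0 ≤ D ≤ E₄`, `F₀^{m+1} > 0`, `𝔖^{m+1} = θ F₀^{m+1}` with `0 ≤ θ ≤ κ`, and `1 − η ≤ ρ`, `0 ≤ η ≤ 1`: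
`|A − V^{m+1} 𝔖^{m+1}| ≤ 2η V^{m+1}𝔖^{m+1} + (3 𝔖^{m+1} E₃ + η 𝔖^{m+1} X + 2κ (E₁ + E₄))`. [folklore] -/
theorem uniform_glue_algebra {A B Sbox Wbox DD Fp Sp Vp θ ρ η E1 E3 E4 X κ : ℝ}
    (hB : B = Sbox - DD) (hB0 : 0 ≤ B)
    (hlow : ρ * Sp * B ≤ Fp * A) (hupp : Fp * A ≤ Sp * ((1 + η) * B + η * Fp * (Wbox + X)))
    (hcube : |Sbox - Fp * Wbox| ≤ E1) (harch : |Wbox - Vp| ≤ E3) (hDD : 0 ≤ DD ∧ DD ≤ E4)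
    (hFp : 0 < Fp) (hθ : θ * Fp = Sp) (hθ0 : 0 ≤ θ) (hθκ : θ ≤ κ)
    (hρ : 1 - η ≤ ρ) (hη0 : 0 ≤ η) (hη1 : η ≤ 1) (hVp : 0 ≤ Vp) (hX : 0 ≤ X) :
    |A - Vp * Sp| ≤ 2 * η * (Vp * Sp) + (3 * (Sp * E3) + η * (Sp * X) + 2 * κ * (E1 + E4)) := by
  have hSp0 : 0 ≤ Sp := by rw [← hθ]; positivity
  have hE10 : 0 ≤ E1 := (abs_nonneg _).trans hcube
  have hE30 : 0 ≤ E3 := (abs_nonneg _).trans harch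
  have hE40 : 0 ≤ E4 := hDD.1.trans hDD.2
  have hκ0 : 0 ≤ κ := hθ0.trans hθκ
  obtain ⟨hc1, hc2⟩ := abs_le.mp hcube
  obtain ⟨ha1, ha2⟩ := abs_le.mp harch
  have hBup : B ≤ Fp * Wbox + E1 := by rw [hB]; linarith [hDD.1]
  have hBlo : Fp * Wbox - E1 - E4 ≤ B := by rw [hB]; linarith [hDD.2]
  have hWup : Wbox ≤ Vp + E3 := by linarith
  have hWlo : Vp - E3 ≤ Wbox := by linarith
  rw [abs_le]
  constructor
  · -- lower bound for `A`
    have h1 : (1 - η) * Sp * B ≤ Fp * A := by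
      have : 0 ≤ (ρ - (1 - η)) * (Sp * B) := mul_nonneg (by linarith) (mul_nonneg hSp0 hB0)
      nlinarith
    have h2 : (1 - η) * Sp * (Fp * Wbox - E1 - E4) ≤ (1 - η) * Sp * B :=
      mul_le_mul_of_nonneg_left hBlo (mul_nonneg (by linarith) hSp0)
    have h3 : (1 - η) * Sp * (Fp * Wbox - E1 - E4) =
        Fp * ((1 - η) * (Sp * Wbox) - (1 - η) * θ * (E1 + E4)) := by rw [← hθ]; ring
    have h4 : (1 - η) * (Sp * Wbox) - (1 - η) * θ * (E1 + E4) ≤ A :=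
      le_of_mul_le_mul_left (by linarith) hFp
    have h5 : (1 - η) * θ * (E1 + E4) ≤ κ * (E1 + E4) := by
      refine mul_le_mul_of_nonneg_right ?_ (by linarith)
      nlinarith
    have h6 : Sp * (Vp - E3) ≤ Sp * Wbox := mul_le_mul_of_nonneg_left hWlo hSp0
    have h7 : η * (Sp * Wbox) ≤ η * (Sp * (Vp + E3)) :=
      mul_le_mul_of_nonneg_left (mul_le_mul_of_nonneg_left hWup hSp0) hη0
    have h8 : 0 ≤ κ * (E1 + E4) := by positivity
    have h9 : 0 ≤ η * (Sp * X) := by positivity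
    have h10 : 0 ≤ η * (Vp * Sp) := by positivity
    nlinarith
  · -- upper bound for `A`
    have h1 : Sp * ((1 + η) * B) ≤ Sp * ((1 + η) * (Fp * Wbox + E1)) :=
      mul_le_mul_of_nonneg_left (mul_le_mul_of_nonneg_left hBup (by linarith)) hSp0
    have h2 : Sp * ((1 + η) * (Fp * Wbox + E1)) + η * Fp * (Wbox + X) * Sp =
        Fp * ((1 + 2 * η) * (Sp * Wbox) + η * (Sp * X) + (1 + η) * (θ * E1)) := by rw [← hθ]; ring
    have h3 : Fp * A ≤ Fp * ((1 + 2 * η) * (Sp * Wbox) + η * (Sp * X) + (1 + η) * (θ * E1)) := by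
      nlinarith
    have h4 : A ≤ (1 + 2 * η) * (Sp * Wbox) + η * (Sp * X) + (1 + η) * (θ * E1) :=
      le_of_mul_le_mul_left h3 hFp
    have h5 : (1 + 2 * η) * (Sp * Wbox) ≤ (1 + 2 * η) * (Sp * (Vp + E3)) :=
      mul_le_mul_of_nonneg_left (mul_le_mul_of_nonneg_left hWup hSp0) (by linarith)
    have h6 : (1 + η) * (θ * E1) ≤ 2 * (κ * E1) :=
      mul_le_mul (by linarith) (mul_le_mul_of_nonneg_right hθκ hE10) (by positivity) (by norm_num)
    have h7 : 0 ≤ κ * E4 := by positivity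
    have h8 : η * (Sp * E3) ≤ 1 * (Sp * E3) := mul_le_mul_of_nonneg_right hη1 (by positivity)
    nlinarith

/-! ### Growth: every junk factor is eventually `≤ η N`, uniformly in the admissible `m` -/

/-- `c N^a ≤ η N` for all large `N` when `a < 1`. [folklore] -/
theorem eventually_const_mul_rpow_le (c : ℝ) {a : ℝ} (ha : a < 1) {η : ℝ} (hη : 0 < η) :
    ∀ᶠ N : ℕ in atTop, c * (N : ℝ) ^ a ≤ η * N := by
  have h1 : Tendsto (fun N : ℕ => (N : ℝ) ^ (1 - a)) atTop atTop :=
    (tendsto_rpow_atTop (by linarith)).comp tendsto_natCast_atTop_atTop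
  filter_upwards [h1.eventually_ge_atTop (c / η), eventually_gt_atTop 0] with N hN hN0
  have hN0' : (0 : ℝ) < N := by exact_mod_cast hN0
  have h2 : c ≤ η * (N : ℝ) ^ (1 - a) := by
    rw [div_le_iff₀ hη] at hN
    linarith [mul_comm η ((N : ℝ) ^ (1 - a))]
  calc c * (N : ℝ) ^ a ≤ η * (N : ℝ) ^ (1 - a) * (N : ℝ) ^ a :=
        mul_le_mul_of_nonneg_right h2 (Real.rpow_nonneg hN0'.le a)
    _ = η * N := by rw [mul_assoc, ← Real.rpow_add hN0', sub_add_cancel, Real.rpow_one]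

/-- Products of four junk factors: `a b c d ≤ N^{α+β+γ+δ}` when `0 ≤ a ≤ N^α`, …, `0 ≤ d ≤ N^δ`. [folklore] -/
theorem mul_le_rpow_add₄ {N : ℝ} (hN : 0 < N) {a b c d α β γ δ : ℝ} (ha0 : 0 ≤ a) (hb0 : 0 ≤ b)
    (hc0 : 0 ≤ c) (hd0 : 0 ≤ d) (ha : a ≤ N ^ α) (hb : b ≤ N ^ β) (hc : c ≤ N ^ γ) (hd : d ≤ N ^ δ) :
    a * b * c * d ≤ N ^ (α + β + γ + δ) := by
  have _ := ha0
  rw [Real.rpow_add hN, Real.rpow_add hN, Real.rpow_add hN]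
  exact mul_le_mul (mul_le_mul (mul_le_mul ha hb hb0 (Real.rpow_nonneg hN.le _)) hc hc0
    (by positivity)) hd hd0 (by positivity)

/-- **The junk of the glue, uniformly in `m`.** For `t ≥ 1`, `C ≥ 0`, `η > 0` and all large `N`, every
`m` with `(m+1)t ≤ (log log N)^A` has (with `T = (m+1)t`, `S = (C (log log N)^{t-1})^{m+1}` the mass bound):
`3 S · m 2^m (N+1)^m ≤ η N^{m+1}`, `S · N^m N^{3/4} ≤ N^{m+1}`,
`2 (3/2)^{m+1} · 4m 7^m N^m N^{(log 4)/4} (log N)^T ≤ η N^{m+1}` and `2 (3/2)^{m+1} · T² 5^m N^m (log N)^T ≤ η N^{m+1}`.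
[folklore] -/
theorem eventually_glue_junk (t A : ℕ) (ht : 1 ≤ t) {C : ℝ} (hC : 0 ≤ C) {η : ℝ} (hη : 0 < η) :
    ∀ᶠ N : ℕ in atTop, ∀ m : ℕ, (((m + 1) * t : ℕ) : ℝ) ≤ Real.log (Real.log N) ^ A →
      3 * ((C * Real.log (Real.log N) ^ (t - 1)) ^ (m + 1) * ((m : ℝ) * 2 ^ m * ((N : ℝ) + 1) ^ m)) ≤
          η * (N : ℝ) ^ (m + 1) ∧
      (C * Real.log (Real.log N) ^ (t - 1)) ^ (m + 1) * ((N : ℝ) ^ m * (N : ℝ) ^ (3 / 4 : ℝ)) ≤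
          (N : ℝ) ^ (m + 1) ∧
      2 * (3 / 2 : ℝ) ^ (m + 1) * (4 * m * 7 ^ m * (N : ℝ) ^ m * (N : ℝ) ^ (Real.log 4 / 4) *
          Real.log N ^ ((m + 1) * t)) ≤ η * (N : ℝ) ^ (m + 1) ∧
      2 * (3 / 2 : ℝ) ^ (m + 1) * ((((m + 1) * t : ℕ) : ℝ) ^ 2 * 5 ^ m * (N : ℝ) ^ m *
          Real.log N ^ ((m + 1) * t)) ≤ η * (N : ℝ) ^ (m + 1) := by
  have hδ : (0 : ℝ) < 1 / 16 := by norm_num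
  have hl4 : Real.log 4 / 4 < 3 / 4 := by
    have := Real.log_lt_sub_one_of_pos (show (0 : ℝ) < 4 by norm_num) (by norm_num)
    linarith
  filter_upwards [eventually_mul_loglog_pow_pow_le_rpow A (t - 1) hC 1 hδ,
    eventually_natCast_pow_le_rpow A 1 1 hδ, eventually_natCast_pow_le_rpow A 2 1 hδ,
    eventually_pow_le_rpow A (show (1 : ℝ) ≤ 7 by norm_num) 1 hδ, eventually_log_pow_le_rpow A 1 hδ,
    eventually_const_mul_rpow_le 3 (show 3 * (1 / 16 : ℝ) < 1 by norm_num) hη,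
    eventually_const_mul_rpow_le 8 (show 4 * (1 / 16 : ℝ) + Real.log 4 / 4 < 1 by linarith) hη,
    eventually_const_mul_rpow_le 2 (show 4 * (1 / 16 : ℝ) < 1 by norm_num) hη,
    eventually_ge_atTop 1, eventually_log_pos, eventually_le_loglog 0]
    with N hS hn1 hn2 h7 hlog hr1 hr2 hr3 hN1 hlogpos hll m hm
  have hN1r : (1 : ℝ) ≤ N := by exact_mod_cast hN1
  have hN0 : (0 : ℝ) < N := by positivity
  have hNm : 0 ≤ (N : ℝ) ^ m := by positivity
  have hr0 : ∀ e : ℝ, 0 ≤ (N : ℝ) ^ e := fun e => Real.rpow_nonneg hN0.le e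
  -- admissibility of `m`, `m + 1`, `T`
  have hT : (((m + 1) * t : ℕ) : ℝ) ≤ 1 * Real.log (Real.log N) ^ A := by rw [one_mul]; exact hm
  have hm1 : ((m + 1 : ℕ) : ℝ) ≤ 1 * Real.log (Real.log N) ^ A := by
    refine le_trans ?_ hT
    exact_mod_cast Nat.le_mul_of_pos_right (m + 1) ht
  have hm0 : ((m : ℕ) : ℝ) ≤ 1 * Real.log (Real.log N) ^ A :=
    le_trans (by exact_mod_cast Nat.le_succ m) hm1
  -- the junk factors
  have jS : (C * Real.log (Real.log N) ^ (t - 1)) ^ (m + 1) ≤ (N : ℝ) ^ (1 / 16 : ℝ) := hS (m + 1) hm1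
  have jm : (m : ℝ) ≤ (N : ℝ) ^ (1 / 16 : ℝ) := by simpa using hn1 m hm0
  have jT2 : (((m + 1) * t : ℕ) : ℝ) ^ 2 ≤ (N : ℝ) ^ (1 / 16 : ℝ) := hn2 _ hT
  have j7 : (7 : ℝ) ^ m ≤ (N : ℝ) ^ (1 / 16 : ℝ) := h7 m hm0
  have j7' : (7 : ℝ) ^ (m + 1) ≤ (N : ℝ) ^ (1 / 16 : ℝ) := h7 (m + 1) hm1
  have j4 : (4 : ℝ) ^ m ≤ (N : ℝ) ^ (1 / 16 : ℝ) :=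
    (pow_le_pow_left₀ (by norm_num) (by norm_num : (4 : ℝ) ≤ 7) m).trans j7
  have j5 : (5 : ℝ) ^ m ≤ (N : ℝ) ^ (1 / 16 : ℝ) :=
    (pow_le_pow_left₀ (by norm_num) (by norm_num : (5 : ℝ) ≤ 7) m).trans j7
  have j32 : (3 / 2 : ℝ) ^ (m + 1) ≤ (N : ℝ) ^ (1 / 16 : ℝ) :=
    (pow_le_pow_left₀ (by norm_num) (by norm_num : (3 / 2 : ℝ) ≤ 7) (m + 1)).trans j7'
  have jlog : Real.log N ^ ((m + 1) * t) ≤ (N : ℝ) ^ (1 / 16 : ℝ) := hlog _ hT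
  have j1 : (1 : ℝ) ≤ (N : ℝ) ^ (0 : ℝ) := by rw [Real.rpow_zero]
  have hS0 : 0 ≤ (C * Real.log (Real.log N) ^ (t - 1)) ^ (m + 1) :=
    pow_nonneg (mul_nonneg hC (pow_nonneg hll _)) _
  have hlog0 : 0 ≤ Real.log N ^ ((m + 1) * t) := pow_nonneg hlogpos.le _
  have e3 : (1 / 16 : ℝ) + 1 / 16 + 1 / 16 + 0 = 3 * (1 / 16) := by norm_num
  have e4 : (1 / 16 : ℝ) + 1 / 16 + 1 / 16 + 1 / 16 = 4 * (1 / 16) := by norm_num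
  refine ⟨?_, ?_, ?_, ?_⟩
  · -- `3 S m 2^m (N+1)^m ≤ 3 N^{3/16} N^m ≤ η N^{m+1}`
    have key : (C * Real.log (Real.log N) ^ (t - 1)) ^ (m + 1) * m * 4 ^ m * 1 ≤
        (N : ℝ) ^ (3 * (1 / 16 : ℝ)) :=
      e3 ▸ mul_le_rpow_add₄ hN0 hS0 (Nat.cast_nonneg m) (by positivity) zero_le_one jS jm j4 j1
    have h2N : ((N : ℝ) + 1) ^ m ≤ (2 : ℝ) ^ m * (N : ℝ) ^ m := by
      rw [← mul_pow]; exact pow_le_pow_left₀ (by positivity) (by linarith) m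
    calc 3 * ((C * Real.log (Real.log N) ^ (t - 1)) ^ (m + 1) * ((m : ℝ) * 2 ^ m * ((N : ℝ) + 1) ^ m))
        ≤ 3 * ((C * Real.log (Real.log N) ^ (t - 1)) ^ (m + 1) * ((m : ℝ) * 2 ^ m * (2 ^ m * (N : ℝ) ^ m))) := by
          gcongr
      _ = 3 * ((C * Real.log (Real.log N) ^ (t - 1)) ^ (m + 1) * m * 4 ^ m * 1) * (N : ℝ) ^ m := by
          rw [show (4 : ℝ) ^ m = 2 ^ m * 2 ^ m by rw [← mul_pow]; norm_num]
          ring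
      _ ≤ 3 * (N : ℝ) ^ (3 * (1 / 16 : ℝ)) * (N : ℝ) ^ m := by gcongr
      _ ≤ η * N * (N : ℝ) ^ m := mul_le_mul_of_nonneg_right hr1 hNm
      _ = η * (N : ℝ) ^ (m + 1) := by ring
  · -- `S N^{3/4} ≤ N^{13/16} ≤ N`
    have key : (C * Real.log (Real.log N) ^ (t - 1)) ^ (m + 1) * (N : ℝ) ^ (3 / 4 : ℝ) ≤ N := by
      calc _ ≤ (N : ℝ) ^ (1 / 16 : ℝ) * (N : ℝ) ^ (3 / 4 : ℝ) := mul_le_mul_of_nonneg_right jS (hr0 _)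
        _ = (N : ℝ) ^ ((1 / 16 : ℝ) + 3 / 4) := by rw [← Real.rpow_add hN0]
        _ ≤ (N : ℝ) ^ (1 : ℝ) := Real.rpow_le_rpow_of_exponent_le hN1r (by norm_num)
        _ = N := Real.rpow_one _
    calc (C * Real.log (Real.log N) ^ (t - 1)) ^ (m + 1) * ((N : ℝ) ^ m * (N : ℝ) ^ (3 / 4 : ℝ))
        = (C * Real.log (Real.log N) ^ (t - 1)) ^ (m + 1) * (N : ℝ) ^ (3 / 4 : ℝ) * (N : ℝ) ^ m := by
          ring
      _ ≤ N * (N : ℝ) ^ m := mul_le_mul_of_nonneg_right key hNm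
      _ = (N : ℝ) ^ (m + 1) := by ring
  · -- `2 (3/2)^{m+1} 4 m 7^m N^{(log 4)/4} (log N)^T ≤ 8 N^{1/4 + (log 4)/4} ≤ η N`
    have key : (3 / 2 : ℝ) ^ (m + 1) * m * 7 ^ m * Real.log N ^ ((m + 1) * t) ≤
        (N : ℝ) ^ (4 * (1 / 16 : ℝ)) :=
      e4 ▸ mul_le_rpow_add₄ hN0 (by positivity) (Nat.cast_nonneg m) (by positivity) hlog0 j32 jm j7 jlog
    calc 2 * (3 / 2 : ℝ) ^ (m + 1) * (4 * m * 7 ^ m * (N : ℝ) ^ m * (N : ℝ) ^ (Real.log 4 / 4) *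
          Real.log N ^ ((m + 1) * t))
        = 8 * ((3 / 2 : ℝ) ^ (m + 1) * m * 7 ^ m * Real.log N ^ ((m + 1) * t)) *
            (N : ℝ) ^ (Real.log 4 / 4) * (N : ℝ) ^ m := by ring
      _ ≤ 8 * (N : ℝ) ^ (4 * (1 / 16 : ℝ)) * (N : ℝ) ^ (Real.log 4 / 4) * (N : ℝ) ^ m := by
          gcongr
      _ = 8 * (N : ℝ) ^ (4 * (1 / 16 : ℝ) + Real.log 4 / 4) * (N : ℝ) ^ m := by
          rw [Real.rpow_add hN0]; ring
      _ ≤ η * N * (N : ℝ) ^ m := mul_le_mul_of_nonneg_right hr2 hNm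
      _ = η * (N : ℝ) ^ (m + 1) := by ring
  · -- `2 (3/2)^{m+1} T² 5^m (log N)^T ≤ 2 N^{1/4} ≤ η N`
    have key : (3 / 2 : ℝ) ^ (m + 1) * (((m + 1) * t : ℕ) : ℝ) ^ 2 * 5 ^ m * Real.log N ^ ((m + 1) * t) ≤
        (N : ℝ) ^ (4 * (1 / 16 : ℝ)) :=
      e4 ▸ mul_le_rpow_add₄ hN0 (by positivity) (by positivity) (by positivity) hlog0 j32 jT2 j5 jlog
    calc 2 * (3 / 2 : ℝ) ^ (m + 1) * ((((m + 1) * t : ℕ) : ℝ) ^ 2 * 5 ^ m * (N : ℝ) ^ m *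
          Real.log N ^ ((m + 1) * t))
        = 2 * ((3 / 2 : ℝ) ^ (m + 1) * (((m + 1) * t : ℕ) : ℝ) ^ 2 * 5 ^ m * Real.log N ^ ((m + 1) * t)) *
            (N : ℝ) ^ m := by ring
      _ ≤ 2 * (N : ℝ) ^ (4 * (1 / 16 : ℝ)) * (N : ℝ) ^ m := by gcongr
      _ ≤ η * N * (N : ℝ) ^ m := mul_le_mul_of_nonneg_right hr3 hNm
      _ = η * (N : ℝ) ^ (m + 1) := by ring

end GlueProof

end Summit.Parity.GeneralizedHardyLittlewood.Cruxes.AbsoluteUpgrade.UniformAmplification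

end
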